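import Summits.CriticalPhenomena.Ising3DConformalLimit.Theses.ReflectionTwin
import Summits.CriticalPhenomena.Ising3DConformalLimit.Theorems.HyperoctahedralRPExistsScaleCovariantLimitDecimationTwoCouplingGKS
import Literature.Probability.LatticeModels.PairIsingLiebSimon
import HarnessLib

/-!
# Seam renewal for the (111) reflection twin, I: objects, slicing geometry, seam bonds

Crux `TwinThreshold` (stmt-CriticalPhenomena-16906, route ReflectionTwin), line `seam_renewal`, stub (W2)
`stub_planeSummable_of_surfaceSummable` ("finite surface susceptibility of the critical (111) half-crystal ⇒ bounded plane sums of
the weakly sewn twin"). This first file fixes, under `namespace ….SeamRenewal.PlaneSummable`, local names for the objects of the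
registered signature, written so that they UNFOLD TO IT DEFINITIONALLY (the registered statement is closed in part IV by `exact`):

* `hh z = z₀ + z₁ + z₂` (the (111) height), `ee i = e_i`;
* `twinW J a b` — the twin coupling matrix entry at lattice sites (n.n. bonds of `ℤ³` except between layers `0` and `1`, seam bonds
  `{c, x}`, `h c = 0`, `h x = 1`, `c + x = e_i`; entry `β_c(3)/2`, times `J` on bonds with a plane endpoint), `twinCpl J L` its
  restriction to the box `Λ_L = box 3 L`, `boxObs` the box monomial (junk `0`), `twinLat` the sup over boxes of the box averages;
* `lowerBox L = {h ≤ -1} ∩ Λ_L`, `halfW` / `halfCpl` / `halfObs` / `halfLat` — the n.n. model at `β_c(3)` on the lower half-crystal;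
* derived finite-volume objects: the box pair function `Gi` (box sites) / `Gs` (lattice sites, junk `0`), the plane `Pl`, layers `±1`
  `Ql`, half-boxes `Bm = {h ≤ -1}`, `Bp = {h ≥ 1}`, plane sums `Ssum`, a finite maximum `fmax` with default `0`, and the two
  spellings of the half-boxes as equivalences `eBm`, `eBp` (`eBp` through the central symmetry `z ↦ -z` of the box).

Then the combinatorics of the slicing (`nn_cases`, `adj_cases`, `adj_plane`, `adj_lower`, `adj_upper`: a plane site bonds only to
`c - e_i` and `e_i - c`; layer `-1` bonds upward only to `u + e_i`; layer `1` bonds downward only along the seam to `e_i - u`; no bond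
crosses two layers), packaged for the proof files as statements about a NONZERO symmetrised coupling `twinW J a b + twinW J b a`
(`plane_nbr_of_cpl_ne_zero`, `lower_nbr_of_cpl_ne_zero`, `upper_nbr_of_cpl_ne_zero`), and the identification of the twin couplings
away from the plane with the n.n. couplings (`twinW_eq_halfW`). Parts II–IV: `…PlaneSummableRenewalBounds.lean` (degree bounds,
Lieb–Simon renewal in a box), `…PlaneSummableRenewalStates.lean` (restricted half-box states = (W1) states; the renewal bound),
`…PlaneSummableOfSurfaceSummable.lean` (volume monotonicity, the statement).

Sources: M. Aizenman, H. Duminil-Copin, Ann. of Math. 194 (2021), Lemma 5.7 (Lieb–Simon for pair interactions; in tree as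
`PairIsing.liebSimon`); B. Simon, Comm. Math. Phys. 77 (1980) 111; E. H. Lieb, ibid. 127; S. Friedli, Y. Velenik (2017) §3.6–3.8.
Design: the definitions are proof-internal bookkeeping for ONE registered statement (no new mathematical notion, no named fact);
the twin adjacency is a file-local notation so that no `Prop`-valued definition is introduced.
-/

noncomputable section

namespace Summit.CriticalPhenomena.Ising3DConformalLimit.Cruxes.TwinThreshold.SeamRenewal.PlaneSummable

open scoped BigOperators Classical
open Filter Topology Finset
open Literature.Probability.LatticeModels
open Summit.CriticalPhenomena.Ising3DConformalLimit.Cruxes.ExistsScaleCovariantLimit.DecimationHomotopyRate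

/-! ## The objects of the registered statement (they unfold to it definitionally) -/

/-- The (111) height `h(z) = z₀ + z₁ + z₂` of a lattice site (`ℤ³` is sliced by the layers `h = const`; every n.n. bond joins
consecutive layers); the `hZ` of the registered signature. [folklore] -/
def hh (z : Site 3) : ℤ := z 0 + z 1 + z 2

/-- The coupling matrix entry `c_{ab}` of the (111) reflection twin `TW(J)` at `β_c(3)` between lattice sites `a`, `b`, written
VERBATIM as in the registered signature: the bonds are the n.n. bonds of `ℤ³` except those between layers `0` and `1`, together
with the seam bonds `{c, x}`, `h c = 0`, `h x = 1`, `c + x = e_i`; the entry is `β_c(3)/2` per orientation (the pair `{a, b}`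
carries `c_{ab} + c_{ba} = β_c`), multiplied by the seam parameter `J` on bonds with an endpoint in the plane `h = 0`, and `0`
off the bonds. [folklore] -/
def twinW (J : ℝ) (a b : Site 3) : ℝ :=
  if (((∑ i, |a i - b i| = 1) ∧ ¬ ((a 0 + a 1 + a 2 = 0 ∧ b 0 + b 1 + b 2 = 1) ∨
      (a 0 + a 1 + a 2 = 1 ∧ b 0 + b 1 + b 2 = 0))) ∨
      (((a 0 + a 1 + a 2 = 0 ∧ b 0 + b 1 + b 2 = 1) ∨ (a 0 + a 1 + a 2 = 1 ∧ b 0 + b 1 + b 2 = 0)) ∧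
        ∃ i : Fin 3, a + b = Pi.single i 1)) then
    (criticalBeta 3 / 2) * (if a 0 + a 1 + a 2 = 0 ∨ b 0 + b 1 + b 2 = 0 then J else 1) else 0

/-- The twin coupling matrix on the free box `Λ_L = box 3 L` (the `cpl J L` of the route file). [folklore] -/
def twinCpl (J : ℝ) (L : ℕ) (a b : ↥(box 3 L)) : ℝ := twinW J a.1 b.1

/-- The box monomial `∏ᵢ σ_{zᵢ}` of a family of lattice sites, with junk factor `0` for a site off the box (so the monomial
vanishes unless all sites are in `Λ_L`), verbatim as in the registered signature. [folklore] -/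
def boxObs (L : ℕ) {k : ℕ} (z : Fin k → Site 3) (s : SpinConfig ↥(box 3 L)) : ℝ :=
  ∏ i, if h : z i ∈ box 3 L then spinAt (⟨z i, h⟩ : ↥(box 3 L)) s else 0

/-- The twin correlation `twinLat J k z = sup_L ⟨∏ᵢ σ_{zᵢ}⟩_{TW(J), Λ_L}` (free boxes, sup over boxes), verbatim as in the
registered signature / the route file `Theses/ReflectionTwin.lean`. [folklore] -/
def twinLat (J : ℝ) (k : ℕ) (z : Fin k → Site 3) : ℝ :=
  ⨆ L : ℕ, PairIsing.gibbsAvg (twinCpl J L) (boxObs L z)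

/-- The lower half-box `H⁻ ∩ Λ_L = {z ∈ Λ_L : h z ≤ -1}` as a finset of lattice sites (spelled as in the signature). [folklore] -/
def lowerBox (L : ℕ) : Finset (Site 3) := (box 3 L).filter (fun x : Site 3 => x 0 + x 1 + x 2 ≤ -1)

/-- The n.n. coupling matrix entry at `β_c(3)`: `β_c/2` per orientation on n.n. pairs, `0` otherwise. [folklore] -/
def halfW (a b : Site 3) : ℝ := if (∑ i, |a i - b i| = 1) then criticalBeta 3 / 2 else (0 : ℝ)

/-- The coupling matrix of the critical n.n. Ising model on the lower half-box `H⁻ ∩ Λ_L` (free boundary). [folklore] -/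
def halfCpl (L : ℕ) (a b : ↥(lowerBox L)) : ℝ := halfW a.1 b.1

/-- The half-box monomial `∏ᵢ σ_{zᵢ}` (junk factor `0` off `H⁻ ∩ Λ_L`), verbatim as in the signature. [folklore] -/
def halfObs (L : ℕ) {k : ℕ} (z : Fin k → Site 3) (s : SpinConfig ↥(lowerBox L)) : ℝ :=
  ∏ i, if h : z i ∈ lowerBox L then spinAt (⟨z i, h⟩ : ↥(lowerBox L)) s else 0

/-- The half-crystal correlation `halfLat k z = sup_L ⟨∏ᵢ σ_{zᵢ}⟩_{H⁻ ∩ Λ_L, β_c(3)}` of hypothesis (W1), verbatim as in the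
registered signature. [folklore] -/
def halfLat (k : ℕ) (z : Fin k → Site 3) : ℝ := ⨆ L : ℕ, PairIsing.gibbsAvg (halfCpl L) (halfObs L z)

/-! ## Derived finite-volume objects: box pair function, plane sums, half-boxes -/

/-- The box pair function `⟨σ_xσ_y⟩_{TW(J), Λ_L}` for box sites. [folklore] -/
def Gi (J : ℝ) (L : ℕ) (x y : ↥(box 3 L)) : ℝ := PairIsing.avg (twinCpl J L) (spinPair x y)

/-- The plane sites of the box. [folklore] -/
def Pl (L : ℕ) : Finset ↥(box 3 L) := univ.filter (fun z => hh z.1 = 0)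

/-- The sites of layers `±1` of the box. [folklore] -/
def Ql (L : ℕ) : Finset ↥(box 3 L) := univ.filter (fun z => hh z.1 = -1 ∨ hh z.1 = 1)

/-- The lower half-box `{h ≤ -1} ∩ Λ_L` (as box sites). [folklore] -/
def Bm (L : ℕ) : Finset ↥(box 3 L) := univ.filter (fun z => hh z.1 ≤ -1)

/-- The upper half-box `{h ≥ 1} ∩ Λ_L` (as box sites). [folklore] -/
def Bp (L : ℕ) : Finset ↥(box 3 L) := univ.filter (fun z => 1 ≤ hh z.1)

/-- The plane sum `S(x) = ∑_{z ∈ plane ∩ Λ_L} ⟨σ_xσ_z⟩`. [folklore] -/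
def Ssum (J : ℝ) (L : ℕ) (x : ↥(box 3 L)) : ℝ := ∑ z ∈ Pl L, Gi J L x z

/-- The box pair function `⟨σ_xσ_y⟩_{TW(J),Λ_L}` at lattice sites (junk `0` off the box). [folklore] -/
def Gs (J : ℝ) (L : ℕ) (x y : Site 3) : ℝ := PairIsing.gibbsAvg (twinCpl J L) (boxObs L ![x, y])

/-- A finite maximum with default `0` (for possibly empty index sets). [folklore] -/
def fmax {α : Type*} (T : Finset α) (f : α → ℝ) : ℝ := if h : T.Nonempty then T.sup' h f else 0

/-- Membership in `Pl`. [folklore] -/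
theorem mem_Pl {L : ℕ} {x : ↥(box 3 L)} : x ∈ Pl L ↔ hh x.1 = 0 := by simp [Pl]

/-- Membership in `Ql`. [folklore] -/
theorem mem_Ql {L : ℕ} {x : ↥(box 3 L)} : x ∈ Ql L ↔ (hh x.1 = -1 ∨ hh x.1 = 1) := by simp [Ql]

/-- Membership in `Bm`. [folklore] -/
theorem mem_Bm {L : ℕ} {x : ↥(box 3 L)} : x ∈ Bm L ↔ hh x.1 ≤ -1 := by simp [Bm]

/-- Membership in `Bp`. [folklore] -/
theorem mem_Bp {L : ℕ} {x : ↥(box 3 L)} : x ∈ Bp L ↔ 1 ≤ hh x.1 := by simp [Bp]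

/-- Membership in `lowerBox`. [folklore] -/
theorem mem_lowerBox {L : ℕ} {y : Site 3} : y ∈ lowerBox L ↔ y ∈ box 3 L ∧ hh y ≤ -1 := Finset.mem_filter

/-- The box is symmetric under `z ↦ -z`. [folklore] -/
theorem neg_mem_box {L : ℕ} {y : Site 3} (hy : y ∈ box 3 L) : -y ∈ box 3 L := by
  rw [mem_box] at hy ⊢
  exact fun i => by have := hy i; rw [Pi.neg_apply]; omega

/-- Members are below the maximum. [folklore] -/
theorem le_fmax {α : Type*} {T : Finset α} (f : α → ℝ) {b : α} (hb : b ∈ T) : f b ≤ fmax T f := by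
  unfold fmax
  rw [dif_pos ⟨b, hb⟩]
  exact Finset.le_sup' f hb

/-- The maximum is below any nonnegative common bound. [folklore] -/
theorem fmax_le {α : Type*} {T : Finset α} {f : α → ℝ} {K : ℝ} (hK : 0 ≤ K) (h : ∀ b ∈ T, f b ≤ K) :
    fmax T f ≤ K := by
  unfold fmax
  split_ifs with hT
  · exact Finset.sup'_le hT f h
  · exact hK

/-- The maximum of nonnegative values is nonnegative. [folklore] -/
theorem fmax_nonneg {α : Type*} {T : Finset α} {f : α → ℝ} (h : ∀ b ∈ T, 0 ≤ f b) : 0 ≤ fmax T f := by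
  unfold fmax
  split_ifs with hT
  · obtain ⟨b, hb⟩ := hT
    exact (h b hb).trans (Finset.le_sup' f hb)
  · exact le_rfl

/-! ## Geometry of the (111) slicing -/

/-- The unit vectors `e_i`. [folklore] -/
def ee (i : Fin 3) : Site 3 := Pi.single i 1

/-- `h(e_i) = 1`. [folklore] -/
theorem hh_ee (i : Fin 3) : hh (ee i) = 1 := by
  fin_cases i <;> simp [hh, ee]

/-- `h` is additive. [folklore] -/
theorem hh_add (a b : Site 3) : hh (a + b) = hh a + hh b := by
  simp only [hh, Pi.add_apply]; ring

/-- `h(a - b) = h a - h b`. [folklore] -/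
theorem hh_sub (a b : Site 3) : hh (a - b) = hh a - hh b := by
  simp only [hh, Pi.sub_apply]; ring

/-- `h(-a) = -h a`. [folklore] -/
theorem hh_neg (a : Site 3) : hh (-a) = -hh a := by
  simp only [hh, Pi.neg_apply]; ring

/-- Nearest neighbours differ by `± e_i`. [folklore] -/
theorem nn_cases {a b : Site 3} (h : ∑ i, |a i - b i| = 1) :
    ∃ i : Fin 3, b = a + ee i ∨ b = a - ee i := by
  rw [Fin.sum_univ_three] at h
  have key : ((b 0 - a 0 = 1 ∨ b 0 - a 0 = -1) ∧ b 1 = a 1 ∧ b 2 = a 2) ∨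
      ((b 1 - a 1 = 1 ∨ b 1 - a 1 = -1) ∧ b 0 = a 0 ∧ b 2 = a 2) ∨
      ((b 2 - a 2 = 1 ∨ b 2 - a 2 = -1) ∧ b 0 = a 0 ∧ b 1 = a 1) := by
    rcases abs_cases (a 0 - b 0) with ⟨h0, _⟩ | ⟨h0, _⟩ <;>
    rcases abs_cases (a 1 - b 1) with ⟨h1, _⟩ | ⟨h1, _⟩ <;>
    rcases abs_cases (a 2 - b 2) with ⟨h2, _⟩ | ⟨h2, _⟩ <;> omega
  rcases key with ⟨h0 | h0, h1, h2⟩ | ⟨h1 | h1, h0, h2⟩ | ⟨h2 | h2, h0, h1⟩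
  · exact ⟨0, Or.inl (funext fun j => by fin_cases j <;> simp [ee] <;> omega)⟩
  · exact ⟨0, Or.inr (funext fun j => by fin_cases j <;> simp [ee] <;> omega)⟩
  · exact ⟨1, Or.inl (funext fun j => by fin_cases j <;> simp [ee] <;> omega)⟩
  · exact ⟨1, Or.inr (funext fun j => by fin_cases j <;> simp [ee] <;> omega)⟩
  · exact ⟨2, Or.inl (funext fun j => by fin_cases j <;> simp [ee] <;> omega)⟩
  · exact ⟨2, Or.inr (funext fun j => by fin_cases j <;> simp [ee] <;> omega)⟩

/-- The twin adjacency `Adj⟪a, b⟫` (the literal `if` condition of `twinW`; a file-local notation, not a declaration). -/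
local notation "Adj⟪" a ", " b "⟫" =>
  (((∑ i, |a i - b i| = 1) ∧ ¬ ((a 0 + a 1 + a 2 = 0 ∧ b 0 + b 1 + b 2 = 1) ∨
      (a 0 + a 1 + a 2 = 1 ∧ b 0 + b 1 + b 2 = 0))) ∨
    (((a 0 + a 1 + a 2 = 0 ∧ b 0 + b 1 + b 2 = 1) ∨ (a 0 + a 1 + a 2 = 1 ∧ b 0 + b 1 + b 2 = 0)) ∧
      ∃ i : Fin 3, a + b = Pi.single i 1))

/-- Master classification of twin bonds. [folklore] -/
theorem adj_cases {a b : Site 3} (h : Adj⟪a, b⟫) :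
    ((∃ i : Fin 3, b = a + ee i ∨ b = a - ee i) ∧ ¬ ((hh a = 0 ∧ hh b = 1) ∨ (hh a = 1 ∧ hh b = 0))) ∨
      (((hh a = 0 ∧ hh b = 1) ∨ (hh a = 1 ∧ hh b = 0)) ∧ ∃ i : Fin 3, b = ee i - a) := by
  rcases h with ⟨hnn, hno⟩ | ⟨h01, i, hi⟩
  · exact Or.inl ⟨nn_cases hnn, hno⟩
  · exact Or.inr ⟨h01, i, by rw [← ee] at hi; rw [← hi, add_sub_cancel_left]⟩

/-- Twin adjacency is symmetric. [folklore] -/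
theorem adj_symm {a b : Site 3} (h : Adj⟪a, b⟫) : Adj⟪b, a⟫ := by
  have hs : ∑ i, |b i - a i| = ∑ i, |a i - b i| := Finset.sum_congr rfl fun i _ => abs_sub_comm _ _
  rcases h with ⟨hnn, hno⟩ | ⟨h01, i, hi⟩
  · refine Or.inl ⟨hs.trans hnn, fun h' => hno ?_⟩
    rcases h' with h' | h'
    · exact Or.inr ⟨h'.2, h'.1⟩
    · exact Or.inl ⟨h'.2, h'.1⟩
  · refine Or.inr ⟨?_, i, by rw [add_comm]; exact hi⟩
    rcases h01 with h' | h'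
    · exact Or.inr ⟨h'.2, h'.1⟩
    · exact Or.inl ⟨h'.2, h'.1⟩

/-- Bonds at a plane site go to `a - e_i` (layer `-1`) or `e_i - a` (layer `1`). [folklore] -/
theorem adj_plane {a b : Site 3} (h : Adj⟪a, b⟫) (ha : hh a = 0) :
    (∃ i : Fin 3, b = a - ee i) ∨ (∃ i : Fin 3, b = ee i - a) := by
  rcases adj_cases h with ⟨⟨i, hb | hb⟩, hno⟩ | ⟨_, i, hb⟩
  · exact absurd (Or.inl ⟨ha, by rw [hb, hh_add, hh_ee, ha]; ring⟩) hno
  · exact Or.inl ⟨i, hb⟩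
  · exact Or.inr ⟨i, hb⟩

/-- Bonds from layer `-1` upwards go to `a + e_i`. [folklore] -/
theorem adj_lower {a b : Site 3} (h : Adj⟪a, b⟫) (ha : hh a = -1) (hb : 0 ≤ hh b) :
    ∃ i : Fin 3, b = a + ee i := by
  rcases adj_cases h with ⟨⟨i, hb' | hb'⟩, _⟩ | ⟨h01, _, _⟩
  · exact ⟨i, hb'⟩
  · rw [hb', hh_sub, hh_ee, ha] at hb; norm_num at hb
  · omega

/-- Bonds from layer `1` downwards are seam bonds to `e_i - a`. [folklore] -/
theorem adj_upper {a b : Site 3} (h : Adj⟪a, b⟫) (ha : hh a = 1) (hb : hh b ≤ 0) :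
    ∃ i : Fin 3, b = ee i - a := by
  rcases adj_cases h with ⟨⟨i, hb' | hb'⟩, hno⟩ | ⟨_, i, hb'⟩
  · rw [hb', hh_add, hh_ee, ha] at hb; norm_num at hb
  · exact absurd (Or.inr ⟨ha, by rw [hb', hh_sub, hh_ee, ha]; ring⟩) hno
  · exact ⟨i, hb'⟩

/-- No bond joins `{h ≤ -2}` to `{h ≥ 0}`. [folklore] -/
theorem not_adj_deep_lower {a b : Site 3} (h : Adj⟪a, b⟫) (ha : hh a ≤ -2) : hh b ≤ -1 := by
  rcases adj_cases h with ⟨⟨i, hb' | hb'⟩, _⟩ | ⟨h01, _, _⟩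
  · rw [hb', hh_add, hh_ee]; omega
  · rw [hb', hh_sub, hh_ee]; omega
  · omega

/-- No bond joins `{h ≥ 2}` to `{h ≤ 0}`. [folklore] -/
theorem not_adj_deep_upper {a b : Site 3} (h : Adj⟪a, b⟫) (ha : 2 ≤ hh a) : 1 ≤ hh b := by
  rcases adj_cases h with ⟨⟨i, hb' | hb'⟩, _⟩ | ⟨h01, _, _⟩
  · rw [hb', hh_add, hh_ee]; omega
  · rw [hb', hh_sub, hh_ee]; omega
  · omega

/-- Off the twin bonds the coupling vanishes. [folklore] -/
theorem twinW_eq_zero {J : ℝ} {a b : Site 3} (h : ¬ Adj⟪a, b⟫) : twinW J a b = 0 := by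
  unfold twinW
  exact if_neg h

/-- Off the twin bonds the symmetrised coupling vanishes. [folklore] -/
theorem cpl_eq_zero {J : ℝ} {a b : Site 3} (h : ¬ Adj⟪a, b⟫) : twinW J a b + twinW J b a = 0 := by
  rw [twinW_eq_zero h, twinW_eq_zero (fun h' => h (adj_symm h')), add_zero]

/-- Away from the plane the twin couplings are the n.n. couplings `β_c/2`. [folklore] -/
theorem twinW_eq_halfW {J : ℝ} {a b : Site 3} (ha : hh a ≠ 0) (hb : hh b ≠ 0) : twinW J a b = halfW a b := by
  have hX : ¬ ((a 0 + a 1 + a 2 = 0 ∧ b 0 + b 1 + b 2 = 1) ∨ (a 0 + a 1 + a 2 = 1 ∧ b 0 + b 1 + b 2 = 0)) := by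
    unfold hh at ha hb; omega
  have hB : ¬ (a 0 + a 1 + a 2 = 0 ∨ b 0 + b 1 + b 2 = 0) := by unfold hh at ha hb; omega
  unfold twinW halfW
  by_cases hn : ∑ i, |a i - b i| = 1
  · have hA : Adj⟪a, b⟫ := Or.inl ⟨hn, hX⟩
    rw [if_pos hA, if_neg hB, if_pos hn, mul_one]
  · have hA : ¬ Adj⟪a, b⟫ := by
      rintro (⟨h, _⟩ | ⟨h, _⟩)
      · exact hn h
      · exact hX h
    rw [if_neg hA, if_neg hn]

/-- A nonzero symmetrised coupling at a plane site `a` points to `a - e_i` (layer `-1`) or to `e_i - a` (layer `1`). [folklore] -/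
theorem plane_nbr_of_cpl_ne_zero {J : ℝ} {a b : Site 3} (ha : hh a = 0) (h : twinW J a b + twinW J b a ≠ 0) :
    (∃ i : Fin 3, b = a - ee i) ∨ (∃ i : Fin 3, b = ee i - a) := by
  by_cases hab : Adj⟪a, b⟫
  · exact adj_plane hab ha
  · exact absurd (cpl_eq_zero hab) h

/-- A nonzero symmetrised coupling from `{h ≤ -1}` to `{h ≥ 0}` joins a layer-`(-1)` site `a` to `a + e_i`. [folklore] -/
theorem lower_nbr_of_cpl_ne_zero {J : ℝ} {a b : Site 3} (ha : hh a ≤ -1) (hb : 0 ≤ hh b)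
    (h : twinW J a b + twinW J b a ≠ 0) : hh a = -1 ∧ ∃ i : Fin 3, b = a + ee i := by
  by_cases hab : Adj⟪a, b⟫
  · have ha1 : hh a = -1 := by
      by_contra hne
      have := not_adj_deep_lower hab (by omega)
      omega
    exact ⟨ha1, adj_lower hab ha1 hb⟩
  · exact absurd (cpl_eq_zero hab) h

/-- A nonzero symmetrised coupling from `{h ≥ 1}` to `{h ≤ 0}` is a seam bond from a layer-`1` site `a` to `e_i - a`. [folklore] -/
theorem upper_nbr_of_cpl_ne_zero {J : ℝ} {a b : Site 3} (ha : 1 ≤ hh a) (hb : hh b ≤ 0)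
    (h : twinW J a b + twinW J b a ≠ 0) : hh a = 1 ∧ ∃ i : Fin 3, b = ee i - a := by
  by_cases hab : Adj⟪a, b⟫
  · have ha1 : hh a = 1 := by
      by_contra hne
      have := not_adj_deep_upper hab (by omega)
      omega
    exact ⟨ha1, adj_upper hab ha1 hb⟩
  · exact absurd (cpl_eq_zero hab) h

/-! ## The two spellings of the half-boxes -/

/-- The copy `↥(Bm L) ≃ ↥(lowerBox L)` (same sites, two spellings). [folklore] -/
def eBm (L : ℕ) : ↥(Bm L) ≃ ↥(lowerBox L) where
  toFun u := ⟨u.1.1, mem_lowerBox.2 ⟨u.1.2, mem_Bm.1 u.2⟩⟩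
  invFun w := ⟨⟨w.1, (mem_lowerBox.1 w.2).1⟩, mem_Bm.2 (mem_lowerBox.1 w.2).2⟩
  left_inv _ := rfl
  right_inv _ := rfl

/-- The reflected copy `↥(Bp L) ≃ ↥(lowerBox L)`, `u ↦ -u` (the box is centrally symmetric). [folklore] -/
def eBp (L : ℕ) : ↥(Bp L) ≃ ↥(lowerBox L) where
  toFun u := ⟨-u.1.1, mem_lowerBox.2 ⟨neg_mem_box u.1.2, by rw [hh_neg]; have := mem_Bp.1 u.2; omega⟩⟩
  invFun w := ⟨⟨-w.1, neg_mem_box (mem_lowerBox.1 w.2).1⟩,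
    mem_Bp.2 (by rw [hh_neg]; have := (mem_lowerBox.1 w.2).2; omega)⟩
  left_inv u := Subtype.ext (Subtype.ext (neg_neg _))
  right_inv w := Subtype.ext (neg_neg _)

end Summit.CriticalPhenomena.Ising3DConformalLimit.Cruxes.TwinThreshold.SeamRenewal.PlaneSummable

namespace Summit.CriticalPhenomena.Ising3DConformalLimit.Cruxes.TwinThreshold.SeamRenewal

open Literature.Probability.LatticeModels

/-- **Registered sub-goal of part I** (anchor of this helper file on the crux item): nearest neighbours of `ℤ³` differ by a unit
vector, `∑ᵢ |aᵢ - bᵢ| = 1 ⇒ b = a ± e_i` (`PlaneSummable.nn_cases`). [folklore] -/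
theorem stub_planeSummable_partI_nn : open Literature.Probability.LatticeModels in (∀ a b : Site 3, (∑ i, |a i - b i| = 1) → ∃ i : Fin 3, b = a + Pi.single i 1 ∨ b = a - Pi.single i 1) :=
  fun _ _ h => PlaneSummable.nn_cases h

end Summit.CriticalPhenomena.Ising3DConformalLimit.Cruxes.TwinThreshold.SeamRenewal

end
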